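import Literature.NumberTheory.LFunctions.RayClassDHCore
import Literature.NumberTheory.LFunctions.RayClassDHEulerNodes
import Literature.NumberTheory.LFunctions.RayClassDHPositivity
import Literature.NumberTheory.LFunctions.DeuringHeilbronnSlots
import HarnessLib

/-!
# Deuring–Heilbronn for congruence class groups, III: the slots of the family

Topic `Literature/NumberTheory/LFunctions` (namespace `Literature.NumberTheory.LFunctions`).  Everything here is PROVED;
`RayClassPrimitiveData.slotWt/slotNode/slotBound/dhSlot`, `primeDivisors`, `principalSlotWt/Node/Bound`,
`principalDHSlot` are definitions with bodies (instances of the abstract `DHSlot` of `DeuringHeilbronnSlots.lean`).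

For a ray class character `ψ mod 𝔪 ≠ 0` of `K`, non-principal off `𝔪`, with primitive data `D` (`χ₀ mod 𝔣`, entire `L`),
Hadamard data `Dx` of the symmetric pair `Ξ = ξ(χ₀)ξ(χ̄₀)` (`RayClassXiPair`) and removal data `R` (artificial zeros
`{1,0}` and, under the flag `w`, the exceptional zero `β`), the **slot of `ψ`** at a point `s` (`Re s > 1`) is the
weighted node family
  core nodes (zeros of `Ξ`, the point `1/2`, the trivial zeros `−j` with weights `2a_j`)
  `⊕` the zeros `i(arg χ₀(𝔭) + 2πn)/log N𝔭`, `i(−arg χ₀(𝔭) + 2πn)/log N𝔭` of the Euler factors of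
  `L_𝔪(s, ψ) = L(s, χ₀) ∏_{𝔭∣𝔪, 𝔭∤𝔣}(1 − χ₀(𝔭)N𝔭^{-s})` and of its conjugate,
with pole coefficient `a = 0`, exceptional multiplicity `e = |B| ∈ {0, 2}`, Dirichlet sides
`P(μ) = P_{2μ−1}(ψ, s)` — the IMPRIMITIVE pair series `mod 𝔪` of `RayClassDHPositivity` — and `M`-bound
`B = (Re s − 1)^{−1} Re Ξ'/Ξ(s) + 2 n_K Z₂ + 2 Σ_{𝔭 bad}(2/σ² + log N𝔭/σ)` (`RayClassPrimitiveData.dhSlot`).  The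
**principal slot** (`principalDHSlot`) is the tree's class-group slot of the trivial character (`ζ_K`, pole coefficient
`a = 2`) with the zeros of `∏_{𝔭∣𝔪}(1 − N𝔭^{-s})` adjoined, Dirichlet sides `P_{2μ−1}(1, s) mod 𝔪`.
This is the bookkeeping of [cite: ThornerZaman2017, §7.2 (7.7)–(7.8) and Lemma 7.3 ("unconditional" case)] with all
four `L`-functions taken imprimitive `mod 𝔪`.

## References
* J. Thorner, A. Zaman, Algebra Number Theory 11 (2017), §7. [ThornerZaman2017]
* J. C. Lagarias, H. L. Montgomery, A. M. Odlyzko, Invent. Math. 54 (1979), §4. [LagariasMontgomeryOdlyzko1979]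
-/

noncomputable section

open scoped NumberField ComplexConjugate
open Complex Filter Topology Set NumberField NumberField.InfinitePlace IsDedekindDomain Classical

namespace Literature.NumberTheory.LFunctions

open Literature.NumberTheory.LFunctions.NumberField Literature.NumberTheory.LFunctions.NumberField.DH
  Literature.NumberTheory.LFunctions.Stark1974

universe u

variable {K : Type u} [Field K] [NumberField K]

/-! ### Two analytic lemmas -/

omit [NumberField K] in
/-- The logarithmic derivative of an analytic non-vanishing function is smooth. [folklore] -/
private theorem contDiffAt_logDeriv_of_ne_zero' {M : ℂ → ℂ} {U : Set ℂ} (hU : IsOpen U) (hM : DifferentiableOn ℂ M U)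
    {s : ℂ} (hs : s ∈ U) (hne : ∀ z ∈ U, M z ≠ 0) (k : ℕ) : ContDiffAt ℂ k (logDeriv M) s := by
  have hd : DifferentiableOn ℂ (logDeriv M) U := by
    intro z hz
    have hMa : AnalyticAt ℂ M z := hM.analyticAt (hU.mem_nhds hz)
    have : logDeriv M = fun w ↦ deriv M w / M w := by funext w; rw [logDeriv_apply]
    rw [this]
    exact (hMa.deriv.differentiableAt.div hMa.differentiableAt (hne z hz)).differentiableWithinAt
  exact (hd.analyticAt (hU.mem_nhds hs)).contDiffAt

omit [NumberField K] in
/-- **The higher logarithmic derivatives of a product**: on an open set where `f, g` are holomorphic and non-zero,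
`(log(fg))'^{(k)} = (log f)'^{(k)} + (log g)'^{(k)}`. [folklore] -/
private theorem iteratedDeriv_logDeriv_mul {f g : ℂ → ℂ} {U : Set ℂ} (hU : IsOpen U) (hf : DifferentiableOn ℂ f U)
    (hg : DifferentiableOn ℂ g U) (hne : ∀ z ∈ U, f z ≠ 0 ∧ g z ≠ 0) {s : ℂ} (hs : s ∈ U) (k : ℕ) :
    iteratedDeriv k (logDeriv (fun z ↦ f z * g z)) s = iteratedDeriv k (logDeriv f) s + iteratedDeriv k (logDeriv g) s := by
  have hev : logDeriv (fun z ↦ f z * g z) =ᶠ[𝓝 s] fun z ↦ logDeriv f z + logDeriv g z := by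
    filter_upwards [hU.mem_nhds hs] with z hz
    exact logDeriv_mul (f := f) (g := g) z (hne z hz).1 (hne z hz).2 (hf.differentiableAt (hU.mem_nhds hz))
      (hg.differentiableAt (hU.mem_nhds hz))
  rw [hev.iteratedDeriv_eq]
  exact iteratedDeriv_fun_add (contDiffAt_logDeriv_of_ne_zero' hU hf hs (fun z hz ↦ (hne z hz).1) k)
    (contDiffAt_logDeriv_of_ne_zero' hU hg hs (fun z hz ↦ (hne z hz).2) k)

/-! ### The slot of a non-principal character -/

namespace RayClassPrimitiveData

variable {𝔪 : Ideal (𝓞 K)} {φ : HeightOneSpectrum (𝓞 K) → ℂ}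

/-- `|φ| ≤ 1` off `𝔪`. [cite: ThornerZaman2017, Lemma 5.3] -/
theorem norm_phi_le_one (D : RayClassPrimitiveData 𝔪 φ) :
    ∀ v : HeightOneSpectrum (𝓞 K), ¬ 𝔪 ≤ v.asIdeal → ‖φ v‖ ≤ 1 := fun v hv ↦ by
  rw [← D.agree v hv]; exact D.norm_le_one v (fun h ↦ hv (D.le.trans h))

section slot

variable (D : RayClassPrimitiveData 𝔪 φ) (hnt : ∃ v : HeightOneSpectrum (𝓞 K), ¬ 𝔪 ≤ v.asIdeal ∧ φ v ≠ 1)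

/-- **The Dirichlet side of the slot is the imprimitive pair series**:
`P_k(φ, s) = P^core_k(s) + ((−1)^{k+1}/k!)[(E'/E)^{(k)} + (Ē'/Ē)^{(k)}](s)` for `Re s > 1`.
[cite: ThornerZaman2017, §7.2 (7.7)] -/
theorem rayPairLSeries_eq_corePair_add {s : ℂ} (hs : 1 < s.re) (k : ℕ) :
    rayPairLSeries 𝔪 φ k s = (D.xiData hnt).corePair k s +
      ((-1) ^ (k + 1) / k.factorial : ℂ) *
        (iteratedDeriv k (logDeriv (eulerProd D.badPrimes D.χ₀)) s +
          iteratedDeriv k (logDeriv (eulerProd D.badPrimes (star D.χ₀))) s) := by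
  have hU : IsOpen {z : ℂ | 1 < z.re} := isOpen_lt continuous_const continuous_re
  have hbad : ∀ v ∈ D.badPrimes, ‖D.χ₀ v‖ = 1 := fun v hv ↦ D.norm_eq_one_of_mem_badPrimes hv
  have hbad' : ∀ v ∈ D.badPrimes, ‖(star D.χ₀) v‖ = 1 := fun v hv ↦ D.norm_conj_eq_one_of_mem_badPrimes hv
  rw [rayPairLSeries_eq_iteratedDeriv_logDeriv D.modulus_ne_bot D.norm_phi_le_one
    (fun z hz ↦ D.neg_logDeriv_LMod_eq' hz) (fun z hz ↦ D.neg_logDeriv_LModConj_eq hz) hs k]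
  have h1 : iteratedDeriv k (logDeriv D.LMod) s =
      iteratedDeriv k (logDeriv D.L) s + iteratedDeriv k (logDeriv (eulerProd D.badPrimes D.χ₀)) s := by
    have : D.LMod = fun z ↦ D.L z * eulerProd D.badPrimes D.χ₀ z := by funext z; rfl
    rw [this]
    exact iteratedDeriv_logDeriv_mul hU D.differentiable.differentiableOn
      (differentiable_eulerProd _ _).differentiableOn
      (fun z hz ↦ ⟨D.L_ne_zero_of_one_le_re hnt (le_of_lt hz), eulerProd_ne_zero _ _ hbad (by
        have : 1 < z.re := hz; linarith)⟩) hs k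
  have h2 : iteratedDeriv k (logDeriv D.LModConj) s =
      iteratedDeriv k (logDeriv D.Lconj) s + iteratedDeriv k (logDeriv (eulerProd D.badPrimes (star D.χ₀))) s := by
    have : D.LModConj = fun z ↦ D.Lconj z * eulerProd D.badPrimes (star D.χ₀) z := by funext z; rfl
    rw [this]
    exact iteratedDeriv_logDeriv_mul hU D.differentiable_Lconj.differentiableOn
      (differentiable_eulerProd _ _).differentiableOn
      (fun z hz ↦ ⟨D.Lconj_ne_zero hnt hz, eulerProd_ne_zero _ _ hbad' (by have : 1 < z.re := hz; linarith)⟩) hs k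
  rw [h1, h2, RayXiData.corePair, xiData_L, xiData_L']
  ring

/-- The weights of the slot: core weights (with removal) and the Euler node weights of `χ₀`, `χ̄₀`.
[cite: ThornerZaman2017, §7.2 (7.8)] -/
def slotWt (Dx : SymmHadamardData (D.xiData hnt).xiPair) (A : Finset ℕ) (B : Finset (ℕ × Bool)) :
    SlotIdx ⊕ (EulerIdx K ⊕ EulerIdx K) → ℝ :=
  Sum.elim ((D.xiData hnt).coreWt Dx A B) (Sum.elim (eulerFamilyWt D.badPrimes) (eulerFamilyWt D.badPrimes))

/-- The nodes of the slot. [cite: ThornerZaman2017, §7.2 (7.8)] -/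
def slotNode (Dx : SymmHadamardData (D.xiData hnt).xiPair) : SlotIdx ⊕ (EulerIdx K ⊕ EulerIdx K) → ℂ :=
  Sum.elim ((D.xiData hnt).coreNode Dx) (Sum.elim (eulerFamilyNode D.χ₀) (eulerFamilyNode (star D.χ₀)))

/-- The `M`-bound of the slot. [cite: ThornerZaman2017, Lemma 7.4] -/
def slotBound (s : ℂ) : ℝ :=
  ((s.re - 1)⁻¹ * (logDeriv (D.xiData hnt).xiPair s).re + 2 * Module.finrank ℚ K * zetaTwo) +
    (∑ v ∈ D.badPrimes, (2 / s.re ^ 2 + Real.log (Ideal.absNorm v.asIdeal : ℕ) / s.re) +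
      ∑ v ∈ D.badPrimes, (2 / s.re ^ 2 + Real.log (Ideal.absNorm v.asIdeal : ℕ) / s.re))

/-- **The node sum of the slot**: `Σ_i w_i (s − ω_i)^{−2μ} = −|B| (s − β)^{−2μ} − P_{2μ−1}(φ, s)`.
[cite: ThornerZaman2017, §7.2 (7.7)] -/
theorem hasSum_slotWt (Dx : SymmHadamardData (D.xiData hnt).xiPair) {β : ℂ} {w : Prop}
    (R : (D.xiData hnt).CoreRemoval Dx β w) {s : ℂ} (hs : 1 < s.re) {μ : ℕ} (hμ : 1 ≤ μ) :
    HasSum (fun i ↦ (D.slotWt hnt Dx R.A R.B i : ℂ) * (((s - D.slotNode hnt Dx i) ^ 2)⁻¹) ^ μ)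
      (((0 : ℝ) : ℂ) * ((s - 1) ^ (2 * μ))⁻¹ - ((R.B.card : ℝ) : ℂ) * ((s - β) ^ (2 * μ))⁻¹ -
        rayPairLSeries 𝔪 φ (2 * μ - 1) s) := by
  have hs0 : 0 < s.re := by linarith
  have hk1 : 1 ≤ 2 * μ - 1 := by omega
  have hk : 2 * μ - 1 + 1 = 2 * μ := by omega
  have hbad : ∀ v ∈ D.badPrimes, ‖D.χ₀ v‖ = 1 := fun v hv ↦ D.norm_eq_one_of_mem_badPrimes hv
  have hbad' : ∀ v ∈ D.badPrimes, ‖(star D.χ₀) v‖ = 1 := fun v hv ↦ D.norm_conj_eq_one_of_mem_badPrimes hv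
  have hcore := (D.xiData hnt).hasSum_coreWt Dx hs hμ R.A R.hA R.B R.hB R.hAB
  have hE := hasSum_eulerFamily D.badPrimes D.χ₀ hbad hs0 hk1
  have hE' := hasSum_eulerFamily D.badPrimes (star D.χ₀) hbad' hs0 hk1
  rw [hk] at hE hE'
  have hEE := HasSum.sum (f := fun i : EulerIdx K ⊕ EulerIdx K ↦
      ((Sum.elim (eulerFamilyWt D.badPrimes) (eulerFamilyWt D.badPrimes) i : ℝ) : ℂ) *
        ((s - Sum.elim (eulerFamilyNode D.χ₀) (eulerFamilyNode (star D.χ₀)) i) ^ (2 * μ))⁻¹)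
    (hE.congr_fun fun i ↦ rfl) (hE'.congr_fun fun i ↦ rfl)
  have hall := HasSum.sum (f := fun i : SlotIdx ⊕ (EulerIdx K ⊕ EulerIdx K) ↦
      (D.slotWt hnt Dx R.A R.B i : ℂ) * (((s - D.slotNode hnt Dx i) ^ 2)⁻¹) ^ μ)
    (hcore.congr_fun fun i ↦ by simp only [Function.comp_apply, slotWt, slotNode, Sum.elim_inl, inv_sq_pow])
    (hEE.congr_fun fun i ↦ by
      rcases i with i | i <;> simp only [Function.comp_apply, slotWt, slotNode, Sum.elim_inl, Sum.elim_inr, inv_sq_pow])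
  convert hall using 1
  rw [D.rayPairLSeries_eq_corePair_add hnt hs (2 * μ - 1), hk, R.cardA]
  have e1 : ((-1 : ℂ) ^ (2 * μ)) = 1 := by rw [pow_mul]; simp
  have e2 : ((-1 : ℂ) ^ (2 * μ - 1)) = -1 := by
    have : (-1 : ℂ) ^ (2 * μ - 1) * (-1) = 1 := by rw [← pow_succ, hk, e1]
    linear_combination -this
  rw [e1, e2]
  push_cast
  ring

/-- **Summability and the `M`-bound of the slot.** [cite: ThornerZaman2017, Lemma 7.4] -/
theorem tsum_slotWt_le (Dx : SymmHadamardData (D.xiData hnt).xiPair) (A : Finset ℕ) (B : Finset (ℕ × Bool))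
    {s : ℂ} (hs : 1 < s.re) :
    Summable (fun i ↦ D.slotWt hnt Dx A B i * ‖((s - D.slotNode hnt Dx i) ^ 2)⁻¹‖) ∧
      ∑' i, D.slotWt hnt Dx A B i * ‖((s - D.slotNode hnt Dx i) ^ 2)⁻¹‖ ≤ D.slotBound hnt s := by
  have hs0 : 0 < s.re := by linarith
  obtain ⟨h1, h1le⟩ := (D.xiData hnt).summable_coreWt_mul_norm Dx hs A B
  obtain ⟨h2, h2le⟩ := tsum_eulerFamilyWt_mul_norm_le D.badPrimes D.χ₀ hs0
  obtain ⟨h3, h3le⟩ := tsum_eulerFamilyWt_mul_norm_le D.badPrimes (star D.χ₀) hs0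
  have hHS := HasSum.sum (f := fun i : SlotIdx ⊕ (EulerIdx K ⊕ EulerIdx K) ↦
      D.slotWt hnt Dx A B i * ‖((s - D.slotNode hnt Dx i) ^ 2)⁻¹‖)
    (h1.hasSum.congr_fun fun i ↦ rfl)
    (HasSum.sum (h2.hasSum.congr_fun fun i ↦ rfl) (h3.hasSum.congr_fun fun i ↦ rfl))
  refine ⟨hHS.summable, ?_⟩
  rw [hHS.tsum_eq]
  exact add_le_add h1le (add_le_add h2le h3le)

/-- **The slot of a non-principal character `mod 𝔪`** at the point `s` (`Re s > 1`), with removal data `R` for the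
exceptional point `β`. [cite: ThornerZaman2017, §7.2 (7.7)–(7.8)] -/
def dhSlot (Dx : SymmHadamardData (D.xiData hnt).xiPair) {β : ℂ} {w : Prop}
    (R : (D.xiData hnt).CoreRemoval Dx β w) {s : ℂ} (hs : 1 < s.re) : DHSlot.{u} s β where
  ι := SlotIdx ⊕ (EulerIdx K ⊕ EulerIdx K)
  w := D.slotWt hnt Dx R.A R.B
  ω := D.slotNode hnt Dx
  a := 0
  e := R.B.card
  P := fun μ ↦ rayPairLSeries 𝔪 φ (2 * μ - 1) s
  B := D.slotBound hnt s
  w_nonneg := by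
    rintro (i | (i | i))
    · exact ((D.xiData hnt).coreWt_nonneg_le Dx R.A R.B i).1
    · exact eulerFamilyWt_nonneg _ i
    · exact eulerFamilyWt_nonneg _ i
  one_le_w := by
    rintro (i | (i | i)) h
    · exact (D.xiData hnt).one_le_coreWt_of_pos Dx R.A R.B h
    · exact one_le_eulerFamilyWt_of_pos _ h
    · exact one_le_eulerFamilyWt_of_pos _ h
  a_nonneg := le_rfl
  a_le := by norm_num
  e_nonneg := Nat.cast_nonneg _
  e_le := by rw [R.cardB]; split_ifs <;> norm_num
  hasSum := fun μ hμ ↦ D.hasSum_slotWt hnt Dx R hs hμ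
  summable := (D.tsum_slotWt_le hnt Dx R.A R.B hs).1
  tsum_le := (D.tsum_slotWt_le hnt Dx R.A R.B hs).2

/-- The Dirichlet side of the slot. [cite: ThornerZaman2017, §7.2 (7.7)] -/
@[simp] theorem dhSlot_P (Dx : SymmHadamardData (D.xiData hnt).xiPair) {β : ℂ} {w : Prop}
    (R : (D.xiData hnt).CoreRemoval Dx β w) {s : ℂ} (hs : 1 < s.re) (μ : ℕ) :
    (D.dhSlot hnt Dx R hs).P μ = rayPairLSeries 𝔪 φ (2 * μ - 1) s := rfl

/-- The pole coefficient of the slot is `0`. [cite: ThornerZaman2017, §7.2 (7.7)] -/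
@[simp] theorem dhSlot_a (Dx : SymmHadamardData (D.xiData hnt).xiPair) {β : ℂ} {w : Prop}
    (R : (D.xiData hnt).CoreRemoval Dx β w) {s : ℂ} (hs : 1 < s.re) : (D.dhSlot hnt Dx R hs).a = 0 := rfl

/-- The exceptional multiplicity of the slot is `2·[w]`. [cite: ThornerZaman2017, §7.2 (7.7)] -/
theorem dhSlot_e (Dx : SymmHadamardData (D.xiData hnt).xiPair) {β : ℂ} {w : Prop}
    (R : (D.xiData hnt).CoreRemoval Dx β w) {s : ℂ} (hs : 1 < s.re) :
    (D.dhSlot hnt Dx R hs).e = 2 * (if w then 1 else 0) := R.cardB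

/-- **A zero `ρ` of `L` with `Re ρ > 0`, `ρ ∉ {1, β}`, is a node of positive weight of the slot.**
[cite: ThornerZaman2017, §7.2] -/
theorem dhSlot_exists_idx (Dx : SymmHadamardData (D.xiData hnt).xiPair) {β : ℂ} {w : Prop}
    (R : (D.xiData hnt).CoreRemoval Dx β w) {s : ℂ} (hs : 1 < s.re) {ρ : ℂ} (hρ0 : 0 < ρ.re) (hρ1 : ρ ≠ 1)
    (hρβ : ρ ≠ β) (hρ : D.L ρ = 0) : ∃ i : (D.dhSlot hnt Dx R hs).ι, 0 < (D.dhSlot hnt Dx R hs).w i ∧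
      (D.dhSlot hnt Dx R hs).ω i = ρ := by
  obtain ⟨i, hi, hiv⟩ := (D.xiData hnt).exists_idx_of_L_eq_zero Dx R.A R.hA R.B (fun q hq ↦ (R.hB q hq).2) hρ0 hρ1
    hρβ (by simpa using hρ)
  exact ⟨Sum.inl i, hi, hiv⟩

/-- **The `M`-bound of the slot**, in the shape needed downstream: for `Re s > 1`,
`B ≤ (Re s − 1)^{−1}·(Re[2/s + 2/(s−1) + log A + 2L_∞'/L_∞(s)] + 2 log N𝔪 − Re P_0(φ, s)) + 2n_K Z₂ +
 2 Σ_{𝔭 bad}(2/σ² + log N𝔭/σ)`, `A = |d_K| N𝔣`. [cite: ThornerZaman2017, Lemma 7.4] -/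
theorem dhSlot_B_le (Dx : SymmHadamardData (D.xiData hnt).xiPair) {β : ℂ} {w : Prop}
    (R : (D.xiData hnt).CoreRemoval Dx β w) {s : ℂ} (hs : 1 < s.re) :
    (D.dhSlot hnt Dx R hs).B ≤
      (s.re - 1)⁻¹ * ((2 / s + 2 / (s - 1) + (Real.log (rayCond K D.𝔣) : ℂ) +
          2 * logDeriv (rayClassGammaFactor K D.p) s).re + 2 * Real.log (Ideal.absNorm 𝔪 : ℕ) -
          (rayPairLSeries 𝔪 φ 0 s).re) + 2 * Module.finrank ℚ K * zetaTwo +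
      2 * ∑ v ∈ D.badPrimes, (2 / s.re ^ 2 + Real.log (Ideal.absNorm v.asIdeal : ℕ) / s.re) := by
  have hα : 0 < s.re - 1 := by linarith
  have hbad : ∀ v ∈ D.badPrimes, ‖D.χ₀ v‖ ≤ 1 := fun v hv ↦ (D.norm_eq_one_of_mem_badPrimes hv).le
  have hbad' : ∀ v ∈ D.badPrimes, ‖(star D.χ₀) v‖ ≤ 1 := fun v hv ↦ (D.norm_conj_eq_one_of_mem_badPrimes hv).le
  have hT : ∀ v ∈ D.badPrimes, v.asIdeal ∣ 𝔪 := fun v hv ↦ D.dvd_of_mem_badPrimes hv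
  have hΞ := (D.xiData hnt).logDeriv_xiPair hs
  have hP0 := D.rayPairLSeries_eq_corePair_add hnt hs 0
  simp only [RayXiData.corePair, iteratedDeriv_zero, zero_add, pow_one, Nat.factorial_zero, Nat.cast_one,
    div_one, xiData_L, xiData_L'] at hP0
  have hE : ‖logDeriv (eulerProd D.badPrimes D.χ₀) s‖ ≤ Real.log (Ideal.absNorm 𝔪 : ℕ) :=
    norm_logDeriv_eulerProd_le D.modulus_ne_bot hT hbad hs
  have hE' : ‖logDeriv (eulerProd D.badPrimes (star D.χ₀)) s‖ ≤ Real.log (Ideal.absNorm 𝔪 : ℕ) :=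
    norm_logDeriv_eulerProd_le D.modulus_ne_bot hT hbad' hs
  have hre : (logDeriv (D.xiData hnt).xiPair s).re ≤
      (2 / s + 2 / (s - 1) + (Real.log (rayCond K D.𝔣) : ℂ) + 2 * logDeriv (rayClassGammaFactor K D.p) s).re +
        2 * Real.log (Ideal.absNorm 𝔪 : ℕ) - (rayPairLSeries 𝔪 φ 0 s).re := by
    have e : logDeriv (D.xiData hnt).xiPair s =
        (2 / s + 2 / (s - 1) + (Real.log (rayCond K D.𝔣) : ℂ) + 2 * logDeriv (rayClassGammaFactor K D.p) s) -
          rayPairLSeries 𝔪 φ 0 s - (logDeriv (eulerProd D.badPrimes D.χ₀) s +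
            logDeriv (eulerProd D.badPrimes (star D.χ₀)) s) := by
      rw [hΞ, hP0, xiData_L, xiData_L']; ring
    rw [e]
    simp only [sub_re, add_re]
    have h1 := Complex.abs_re_le_norm (logDeriv (eulerProd D.badPrimes D.χ₀) s)
    have h2 := Complex.abs_re_le_norm (logDeriv (eulerProd D.badPrimes (star D.χ₀)) s)
    linarith [(abs_le.mp h1).1, (abs_le.mp h2).1]
  have hmul := mul_le_mul_of_nonneg_left hre (inv_pos.mpr hα).le
  show D.slotBound hnt s ≤ _
  unfold slotBound
  linarith

end slot

end RayClassPrimitiveData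

/-! ### The principal slot -/

section principal

variable (K)
variable {𝔪 : Ideal (𝓞 K)} (h𝔪 : 𝔪 ≠ ⊥)

/-- The prime divisors of `𝔪`. [cite: ThornerZaman2017, Lemma 7.3] -/
def primeDivisors : Finset (HeightOneSpectrum (𝓞 K)) := (Ideal.finite_factors h𝔪).toFinset

variable {K}

/-- Members of `primeDivisors` divide `𝔪`. [cite: ThornerZaman2017, Lemma 7.3] -/
theorem dvd_of_mem_primeDivisors {v : HeightOneSpectrum (𝓞 K)} (hv : v ∈ primeDivisors K h𝔪) : v.asIdeal ∣ 𝔪 := by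
  rw [primeDivisors, Set.Finite.mem_toFinset, Set.mem_setOf_eq] at hv; exact hv

/-- `L_𝔪(s, 1) = ζ_K(s) · E₀(s)`, `E₀ = ∏_{𝔭∣𝔪}(1 − N𝔭^{-s})`, for `Re s > 1` (with the tree's continuation
`classGroupLFunction K 1` of `ζ_K`). [cite: NeukirchANT1999, Ch. VII §8 (8.1)] -/
theorem zeta_mul_eulerProd_eq_rayClassLSeries {s : ℂ} (hs : 1 < s.re) :
    classGroupLFunction K 1 s * eulerProd (primeDivisors K h𝔪) (fun _ ↦ (1 : ℂ)) s =
      rayClassLSeries 𝔪 (fun _ ↦ (1 : ℂ)) s := by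
  have hs1 : s ≠ 1 := fun h ↦ by rw [h, one_re] at hs; exact lt_irrefl _ hs
  rw [AbelianDensity.rayClassLSeries_one_eq_dedekindZeta_mul_prod h𝔪 hs, classGroupLFunction_one K hs1,
    dedekindZetaCont_eq_dedekindZeta_holds hs, eulerProd, primeDivisors]
  congr 1
  exact Finset.prod_congr rfl fun v _ ↦ by rw [one_mul]

/-- `−(L_𝔪'/L_𝔪)(s, 1) = L(Λ^𝔪_1, s)` for `Re s > 1`. [cite: LagariasOdlyzko1977, Lemma 5.3] -/
theorem neg_logDeriv_zeta_mul_eulerProd_eq {s : ℂ} (hs : 1 < s.re) :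
    -(deriv (fun z ↦ classGroupLFunction K 1 z * eulerProd (primeDivisors K h𝔪) (fun _ ↦ (1 : ℂ)) z) s /
        ((fun z ↦ classGroupLFunction K 1 z * eulerProd (primeDivisors K h𝔪) (fun _ ↦ (1 : ℂ)) z) s)) =
      LSeries (twistVonMangoldt K (rayClassCoeffHom 𝔪 (fun _ ↦ (1 : ℂ)))) s :=
  neg_logDeriv_continuation_eq_LSeries h𝔪 (fun v _ ↦ by simp)
    (L := fun z ↦ classGroupLFunction K 1 z * eulerProd (primeDivisors K h𝔪) (fun _ ↦ (1 : ℂ)) z)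
    (fun z hz ↦ zeta_mul_eulerProd_eq_rayClassLSeries h𝔪 hz) hs

/-- **The Dirichlet side of the principal slot**: for `Re s > 1`,
`P_k(1, s) mod 𝔪 = pairLSeries K 1 k s + 2 ((−1)^{k+1}/k!) (E₀'/E₀)^{(k)}(s)`. [cite: ThornerZaman2017, §7.2 (7.7)] -/
theorem rayPairLSeries_one_eq {s : ℂ} (hs : 1 < s.re) (k : ℕ) :
    rayPairLSeries 𝔪 (fun _ ↦ (1 : ℂ)) k s = pairLSeries K 1 k s +
      2 * (((-1) ^ (k + 1) / k.factorial : ℂ) *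
        iteratedDeriv k (logDeriv (eulerProd (primeDivisors K h𝔪) (fun _ ↦ (1 : ℂ)))) s) := by
  have hU : IsOpen {z : ℂ | 1 < z.re} := isOpen_lt continuous_const continuous_re
  set E₀ : ℂ → ℂ := eulerProd (primeDivisors K h𝔪) (fun _ ↦ (1 : ℂ)) with hE₀
  have hone : ∀ v ∈ primeDivisors K h𝔪, ‖(fun _ : HeightOneSpectrum (𝓞 K) ↦ (1 : ℂ)) v‖ = 1 := fun v _ ↦ by simp
  have hconj : (fun v : HeightOneSpectrum (𝓞 K) ↦ conj ((fun _ : HeightOneSpectrum (𝓞 K) ↦ (1 : ℂ)) v)) =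
      fun _ ↦ (1 : ℂ) := by
    funext v; simp
  have hM : ∀ z : ℂ, 1 < z.re →
      -(deriv (fun z ↦ classGroupLFunction K 1 z * E₀ z) z / ((fun z ↦ classGroupLFunction K 1 z * E₀ z) z)) =
        LSeries (twistVonMangoldt K (rayClassCoeffHom 𝔪 (fun _ ↦ (1 : ℂ)))) z :=
    fun z hz ↦ neg_logDeriv_zeta_mul_eulerProd_eq (K := K) h𝔪 hz
  have hM' : ∀ z : ℂ, 1 < z.re →
      -(deriv (fun z ↦ classGroupLFunction K 1 z * E₀ z) z / ((fun z ↦ classGroupLFunction K 1 z * E₀ z) z)) =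
        LSeries (twistVonMangoldt K (rayClassCoeffHom 𝔪
          (fun v ↦ conj ((fun _ : HeightOneSpectrum (𝓞 K) ↦ (1 : ℂ)) v)))) z := by
    intro z hz; rw [hconj]; exact hM z hz
  have hray := rayPairLSeries_eq_iteratedDeriv_logDeriv h𝔪 (φ := fun _ ↦ (1 : ℂ)) (fun v _ ↦ by simp) hM hM' hs k
  have hsplit : iteratedDeriv k (logDeriv (fun z ↦ classGroupLFunction K 1 z * E₀ z)) s =
      iteratedDeriv k (logDeriv (classGroupLFunction K 1)) s + iteratedDeriv k (logDeriv E₀) s := by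
    refine iteratedDeriv_logDeriv_mul hU ?_ (differentiable_eulerProd _ _).differentiableOn ?_ hs k
    · intro z hz
      have hz1 : z ≠ 1 := fun h ↦ by have : 1 < z.re := hz; rw [h, one_re] at this; exact lt_irrefl _ this
      exact ((differentiableOn_classGroupLFunction (K := K) 1).differentiableAt
        (isOpen_compl_singleton.mem_nhds hz1)).differentiableWithinAt
    · intro z hz
      have hz' : 1 < z.re := hz
      exact ⟨classGroupLFunction_ne_zero_of_one_lt_re K 1 hz', eulerProd_ne_zero _ _ hone (by linarith)⟩
  have hpair : pairLSeries K 1 k s = 2 * (((-1) ^ (k + 1) / k.factorial : ℂ) *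
      iteratedDeriv k (logDeriv (classGroupLFunction K 1)) s) := by
    have hinv : (1 : ClassGroup (𝓞 K) →* ℂˣ)⁻¹ = 1 := by ext C; simp
    rw [pairLSeries_eq_iteratedDeriv 1 k hs, hinv]
    have hev : LSeries (twistVonMangoldt K (classGroupCharIdealHom (1 : ClassGroup (𝓞 K) →* ℂˣ))) =ᶠ[𝓝 s]
        fun z ↦ -logDeriv (classGroupLFunction K 1) z := by
      filter_upwards [hU.mem_nhds hs] with z hz
      rw [logDeriv_classGroupLFunction_eq_neg_LSeries 1 hz, neg_neg]
    rw [hev.iteratedDeriv_eq, iteratedDeriv_fun_neg, pow_succ]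
    ring
  rw [hray, hsplit, hpair]
  ring

/-- The weights of the principal slot: the tree's class-group weights of `ζ_K` (with removal) and the Euler node
weights of `∏_{𝔭∣𝔪}(1 − N𝔭^{-s})` twice. [cite: ThornerZaman2017, §7.2 (7.8)] -/
def principalSlotWt (D₀ : SymmHadamardData (classXiPair K (1 : ClassGroup (𝓞 K) →* ℂˣ))) (A : Finset ℕ)
    (B : Finset (ℕ × Bool)) : SlotIdx ⊕ (EulerIdx K ⊕ EulerIdx K) → ℝ :=
  Sum.elim (slotWt' D₀ A B) (Sum.elim (eulerFamilyWt (primeDivisors K h𝔪)) (eulerFamilyWt (primeDivisors K h𝔪)))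

/-- The nodes of the principal slot. [cite: ThornerZaman2017, §7.2 (7.8)] -/
def principalSlotNode (D₀ : SymmHadamardData (classXiPair K (1 : ClassGroup (𝓞 K) →* ℂˣ))) :
    SlotIdx ⊕ (EulerIdx K ⊕ EulerIdx K) → ℂ :=
  Sum.elim (slotNode D₀) (Sum.elim (eulerFamilyNode (fun _ ↦ (1 : ℂ))) (eulerFamilyNode (fun _ ↦ (1 : ℂ))))

variable (K) in
/-- The `M`-bound of the principal slot. [cite: ThornerZaman2017, Lemma 7.4] -/
def principalSlotBound (s : ℂ) : ℝ :=
  ((s.re - 1)⁻¹ * ((2 / s + 2 / (s - 1) + 2 * logDeriv (dedekindGammaFactor K) s).re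
        - (pairLSeries K 1 0 s).re) + 2 * Module.finrank ℚ K * zetaTwo) +
    (∑ v ∈ primeDivisors K h𝔪, (2 / s.re ^ 2 + Real.log (Ideal.absNorm v.asIdeal : ℕ) / s.re) +
      ∑ v ∈ primeDivisors K h𝔪, (2 / s.re ^ 2 + Real.log (Ideal.absNorm v.asIdeal : ℕ) / s.re))

/-- **The node sum of the principal slot**: `Σ w (s − ω)^{−2μ} = 2(s−1)^{−2μ} − |B|(s−β)^{−2μ} − P_{2μ−1}(1, s) mod 𝔪`.
[cite: ThornerZaman2017, §7.2 (7.7)] -/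
theorem hasSum_principalSlotWt (D₀ : SymmHadamardData (classXiPair K (1 : ClassGroup (𝓞 K) →* ℂˣ))) {β : ℂ}
    {w : Prop} (R₀ : Removal D₀ β w) {s : ℂ} (hs : 1 < s.re) {μ : ℕ} (hμ : 1 ≤ μ) :
    HasSum (fun i ↦ (principalSlotWt h𝔪 D₀ R₀.A R₀.B i : ℂ) * (((s - principalSlotNode D₀ i) ^ 2)⁻¹) ^ μ)
      (((2 : ℝ) : ℂ) * ((s - 1) ^ (2 * μ))⁻¹ - ((R₀.B.card : ℝ) : ℂ) * ((s - β) ^ (2 * μ))⁻¹ -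
        rayPairLSeries 𝔪 (fun _ ↦ (1 : ℂ)) (2 * μ - 1) s) := by
  have hs0 : 0 < s.re := by linarith
  have hk1 : 1 ≤ 2 * μ - 1 := by omega
  have hk : 2 * μ - 1 + 1 = 2 * μ := by omega
  have hone : ∀ v ∈ primeDivisors K h𝔪, ‖(fun _ : HeightOneSpectrum (𝓞 K) ↦ (1 : ℂ)) v‖ = 1 := fun v _ ↦ by simp
  have hcore := hasSum_slot_removed D₀ hs hμ R₀.A R₀.hA R₀.B R₀.hB R₀.hAB
  have hE := hasSum_eulerFamily (primeDivisors K h𝔪) (fun _ ↦ (1 : ℂ)) hone hs0 hk1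
  rw [hk] at hE
  have hEE := HasSum.sum (f := fun i : EulerIdx K ⊕ EulerIdx K ↦
      ((Sum.elim (eulerFamilyWt (primeDivisors K h𝔪)) (eulerFamilyWt (primeDivisors K h𝔪)) i : ℝ) : ℂ) *
        ((s - Sum.elim (eulerFamilyNode (fun _ ↦ (1 : ℂ))) (eulerFamilyNode (fun _ ↦ (1 : ℂ))) i) ^ (2 * μ))⁻¹)
    (hE.congr_fun fun i ↦ rfl) (hE.congr_fun fun i ↦ rfl)
  have hall := HasSum.sum (f := fun i : SlotIdx ⊕ (EulerIdx K ⊕ EulerIdx K) ↦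
      (principalSlotWt h𝔪 D₀ R₀.A R₀.B i : ℂ) * (((s - principalSlotNode D₀ i) ^ 2)⁻¹) ^ μ)
    (hcore.congr_fun fun i ↦ by
      simp only [Function.comp_apply, principalSlotWt, principalSlotNode, Sum.elim_inl, inv_sq_pow])
    (hEE.congr_fun fun i ↦ by
      rcases i with i | i <;>
        simp only [Function.comp_apply, principalSlotWt, principalSlotNode, Sum.elim_inl, Sum.elim_inr, inv_sq_pow])
  convert hall using 1
  rw [rayPairLSeries_one_eq h𝔪 hs (2 * μ - 1), hk]
  have hA : (R₀.A.card : ℂ) = 0 := by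
    have h := R₀.cardA
    rw [poleInd_eq, if_pos rfl] at h
    norm_num at h
    rw [h]; simp
  have hpole : (poleInd (1 : ClassGroup (𝓞 K) →* ℂˣ) : ℂ) = 1 := by rw [poleInd_eq, if_pos rfl]; simp
  have e1 : ((-1 : ℂ) ^ (2 * μ)) = 1 := by rw [pow_mul]; simp
  have e2 : ((-1 : ℂ) ^ (2 * μ - 1)) = -1 := by
    have : (-1 : ℂ) ^ (2 * μ - 1) * (-1) = 1 := by rw [← pow_succ, hk, e1]
    linear_combination -this
  rw [hA, hpole, e1, e2]
  push_cast
  ring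

/-- **Summability and the `M`-bound of the principal slot.** [cite: ThornerZaman2017, Lemma 7.4] -/
theorem tsum_principalSlotWt_le (D₀ : SymmHadamardData (classXiPair K (1 : ClassGroup (𝓞 K) →* ℂˣ)))
    (A : Finset ℕ) (B : Finset (ℕ × Bool)) {s : ℂ} (hs : 1 < s.re) :
    Summable (fun i ↦ principalSlotWt h𝔪 D₀ A B i * ‖((s - principalSlotNode D₀ i) ^ 2)⁻¹‖) ∧
      ∑' i, principalSlotWt h𝔪 D₀ A B i * ‖((s - principalSlotNode D₀ i) ^ 2)⁻¹‖ ≤ principalSlotBound K h𝔪 s := by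
  have hs0 : 0 < s.re := by linarith
  have h0 := summable_slotWt_mul_norm D₀ hs
  have hle : ∀ i, slotWt' D₀ A B i * ‖((s - slotNode D₀ i) ^ 2)⁻¹‖ ≤ slotWt D₀ i * ‖((s - slotNode D₀ i) ^ 2)⁻¹‖ :=
    fun i ↦ mul_le_mul_of_nonneg_right (slotWt'_nonneg_le D₀ A B i).2 (norm_nonneg _)
  have h1 : Summable fun i : SlotIdx ↦ slotWt' D₀ A B i * ‖((s - slotNode D₀ i) ^ 2)⁻¹‖ :=
    Summable.of_nonneg_of_le (fun i ↦ mul_nonneg (slotWt'_nonneg_le D₀ A B i).1 (norm_nonneg _)) hle h0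
  have h1le : ∑' i, slotWt' D₀ A B i * ‖((s - slotNode D₀ i) ^ 2)⁻¹‖ ≤
      (s.re - 1)⁻¹ * ((2 / s + 2 / (s - 1) + 2 * logDeriv (dedekindGammaFactor K) s).re
        - (pairLSeries K 1 0 s).re) + 2 * Module.finrank ℚ K * zetaTwo :=
    (h1.tsum_le_tsum hle h0).trans (tsum_slotWt_mul_norm_le D₀ hs)
  obtain ⟨h2, h2le⟩ := tsum_eulerFamilyWt_mul_norm_le (primeDivisors K h𝔪) (fun _ ↦ (1 : ℂ)) hs0
  have hHS := HasSum.sum (f := fun i : SlotIdx ⊕ (EulerIdx K ⊕ EulerIdx K) ↦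
      principalSlotWt h𝔪 D₀ A B i * ‖((s - principalSlotNode D₀ i) ^ 2)⁻¹‖)
    (h1.hasSum.congr_fun fun i ↦ rfl)
    (HasSum.sum (h2.hasSum.congr_fun fun i ↦ rfl) (h2.hasSum.congr_fun fun i ↦ rfl))
  refine ⟨hHS.summable, ?_⟩
  rw [hHS.tsum_eq]
  exact add_le_add h1le (add_le_add h2le h2le)

/-- **The principal slot** (`ζ_K` with the Euler factors at `𝔪` adjoined) at the point `s` (`Re s > 1`), built from the
tree's class-group slot of the trivial character with removal data `R₀`. [cite: ThornerZaman2017, §7.2 (7.7)–(7.8)] -/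
def principalDHSlot (D₀ : SymmHadamardData (classXiPair K (1 : ClassGroup (𝓞 K) →* ℂˣ))) {β : ℂ} {w : Prop}
    (R₀ : Removal D₀ β w) {s : ℂ} (hs : 1 < s.re) : DHSlot.{u} s β where
  ι := SlotIdx ⊕ (EulerIdx K ⊕ EulerIdx K)
  w := principalSlotWt h𝔪 D₀ R₀.A R₀.B
  ω := principalSlotNode D₀
  a := 2
  e := R₀.B.card
  P := fun μ ↦ rayPairLSeries 𝔪 (fun _ ↦ (1 : ℂ)) (2 * μ - 1) s
  B := principalSlotBound K h𝔪 s
  w_nonneg := by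
    rintro (i | (i | i))
    · exact (slotWt'_nonneg_le D₀ R₀.A R₀.B i).1
    · exact eulerFamilyWt_nonneg _ i
    · exact eulerFamilyWt_nonneg _ i
  one_le_w := by
    rintro (i | (i | i)) h
    · exact one_le_slotWt'_of_pos D₀ R₀.A R₀.B h
    · exact one_le_eulerFamilyWt_of_pos _ h
    · exact one_le_eulerFamilyWt_of_pos _ h
  a_nonneg := by norm_num
  a_le := le_rfl
  e_nonneg := Nat.cast_nonneg _
  e_le := by rw [R₀.cardB]; split_ifs <;> norm_num
  hasSum := fun μ hμ ↦ hasSum_principalSlotWt h𝔪 D₀ R₀ hs hμ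
  summable := (tsum_principalSlotWt_le h𝔪 D₀ R₀.A R₀.B hs).1
  tsum_le := (tsum_principalSlotWt_le h𝔪 D₀ R₀.A R₀.B hs).2

/-- The Dirichlet side of the principal slot. [cite: ThornerZaman2017, §7.2 (7.7)] -/
@[simp] theorem principalDHSlot_P (D₀ : SymmHadamardData (classXiPair K (1 : ClassGroup (𝓞 K) →* ℂˣ))) {β : ℂ}
    {w : Prop} (R₀ : Removal D₀ β w) {s : ℂ} (hs : 1 < s.re) (μ : ℕ) :
    (principalDHSlot h𝔪 D₀ R₀ hs).P μ = rayPairLSeries 𝔪 (fun _ ↦ (1 : ℂ)) (2 * μ - 1) s := rfl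

/-- The pole coefficient of the principal slot is `2`. [cite: ThornerZaman2017, §7.2 (7.7)] -/
@[simp] theorem principalDHSlot_a (D₀ : SymmHadamardData (classXiPair K (1 : ClassGroup (𝓞 K) →* ℂˣ))) {β : ℂ}
    {w : Prop} (R₀ : Removal D₀ β w) {s : ℂ} (hs : 1 < s.re) : (principalDHSlot h𝔪 D₀ R₀ hs).a = 2 := rfl

/-- The exceptional multiplicity of the principal slot is `2·[w]`. [cite: ThornerZaman2017, §7.2 (7.7)] -/
theorem principalDHSlot_e (D₀ : SymmHadamardData (classXiPair K (1 : ClassGroup (𝓞 K) →* ℂˣ))) {β : ℂ}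
    {w : Prop} (R₀ : Removal D₀ β w) {s : ℂ} (hs : 1 < s.re) :
    (principalDHSlot h𝔪 D₀ R₀ hs).e = 2 * (if w then 1 else 0) := R₀.cardB

/-- **A zero `ρ` of `ζ_K` with `Re ρ > 0`, `ρ ∉ {1, β}`, is a node of positive weight of the principal slot.**
[cite: ThornerZaman2017, §7.2] -/
theorem principalDHSlot_exists_idx (D₀ : SymmHadamardData (classXiPair K (1 : ClassGroup (𝓞 K) →* ℂˣ))) {β : ℂ}
    {w : Prop} (R₀ : Removal D₀ β w) {s : ℂ} (hs : 1 < s.re) {ρ : ℂ} (hρ0 : 0 < ρ.re) (hρ1 : ρ ≠ 1)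
    (hρβ : ρ ≠ β) (hρ : classGroupLFunction K 1 ρ = 0) :
    ∃ i : (principalDHSlot h𝔪 D₀ R₀ hs).ι, 0 < (principalDHSlot h𝔪 D₀ R₀ hs).w i ∧
      (principalDHSlot h𝔪 D₀ R₀ hs).ω i = ρ := by
  obtain ⟨i, hi, hiv⟩ := exists_idx_of_classGroupLFunction_eq_zero D₀ hρ0 hρ1 hρ
  have hρ00 : ρ ≠ 0 := fun h ↦ by rw [h, zero_re] at hρ0; exact lt_irrefl _ hρ0
  refine ⟨Sum.inl i, ?_, by simpa [principalDHSlot, principalSlotNode] using hiv⟩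
  exact slotWt'_pos D₀ R₀.A R₀.hA R₀.B (fun q hq ↦ (R₀.hB q hq).2) hi (hiv ▸ hρ1) (hiv ▸ hρ00) (hiv ▸ hρβ)

/-- **The `M`-bound of the principal slot**, in the shape needed downstream: for `Re s > 1`,
`B ≤ (Re s − 1)^{−1}(Re[2/s + 2/(s−1) + 2γ_K'/γ_K(s)] + 2 log N𝔪 − Re P_0(1, s)) + 2n_K Z₂ + 2Σ_{𝔭∣𝔪}(2/σ² + log N𝔭/σ)`.
[cite: ThornerZaman2017, Lemma 7.4] -/
theorem principalDHSlot_B_le (D₀ : SymmHadamardData (classXiPair K (1 : ClassGroup (𝓞 K) →* ℂˣ))) {β : ℂ}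
    {w : Prop} (R₀ : Removal D₀ β w) {s : ℂ} (hs : 1 < s.re) :
    (principalDHSlot h𝔪 D₀ R₀ hs).B ≤
      (s.re - 1)⁻¹ * ((2 / s + 2 / (s - 1) + 2 * logDeriv (dedekindGammaFactor K) s).re +
          2 * Real.log (Ideal.absNorm 𝔪 : ℕ) - (rayPairLSeries 𝔪 (fun _ ↦ (1 : ℂ)) 0 s).re) +
        2 * Module.finrank ℚ K * zetaTwo +
      2 * ∑ v ∈ primeDivisors K h𝔪, (2 / s.re ^ 2 + Real.log (Ideal.absNorm v.asIdeal : ℕ) / s.re) := by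
  have hα : 0 < s.re - 1 := by linarith
  have hT : ∀ v ∈ primeDivisors K h𝔪, v.asIdeal ∣ 𝔪 := fun v hv ↦ dvd_of_mem_primeDivisors h𝔪 hv
  have h0 := rayPairLSeries_one_eq (K := K) h𝔪 hs 0
  simp only [iteratedDeriv_zero, zero_add, pow_one, Nat.factorial_zero, Nat.cast_one, div_one] at h0
  have hE : ‖logDeriv (eulerProd (primeDivisors K h𝔪) (fun _ ↦ (1 : ℂ))) s‖ ≤ Real.log (Ideal.absNorm 𝔪 : ℕ) :=
    norm_logDeriv_eulerProd_le h𝔪 hT (c := fun _ ↦ (1 : ℂ)) (fun v _ ↦ by simp) hs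
  have hre : -(pairLSeries K 1 0 s).re ≤ 2 * Real.log (Ideal.absNorm 𝔪 : ℕ) -
      (rayPairLSeries 𝔪 (fun _ ↦ (1 : ℂ)) 0 s).re := by
    have e : pairLSeries K 1 0 s = rayPairLSeries 𝔪 (fun _ ↦ (1 : ℂ)) 0 s +
        2 * logDeriv (eulerProd (primeDivisors K h𝔪) (fun _ ↦ (1 : ℂ))) s := by
      rw [h0]; ring
    rw [e, add_re]
    have h1 := Complex.abs_re_le_norm (logDeriv (eulerProd (primeDivisors K h𝔪) (fun _ ↦ (1 : ℂ))) s)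
    have h2 : ((2 : ℂ) * logDeriv (eulerProd (primeDivisors K h𝔪) (fun _ ↦ (1 : ℂ))) s).re =
        2 * (logDeriv (eulerProd (primeDivisors K h𝔪) (fun _ ↦ (1 : ℂ))) s).re := by simp
    rw [h2]
    linarith [(abs_le.mp h1).1]
  have hmul := mul_le_mul_of_nonneg_left hre (inv_pos.mpr hα).le
  show principalSlotBound K h𝔪 s ≤ _
  unfold principalSlotBound
  nlinarith [inv_pos.mpr hα, hmul]

end principal

end Literature.NumberTheory.LFunctions

end
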